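import Summits.PneNP.PneNP.Theorems.MonotoneContinuation.Negative.StarParity

/-!
# `MonotoneContinuation` (stmt-PneNP-18471) — negative-side lemmas IV-A: a sparse parity is far from every monotone function

General form of `StarParity.lean` (there: the star of a vertex at `p = 1/n`): for an edge set `T` with `#T ≥ 2`,
`7/8 ≤ #T·p ≤ 1` and `0 < p ≤ 1/8`, every monotone Boolean `F` satisfies `‖𝟙[F] − 𝟙[parity of #(· ∩ T)]‖_{L¹(G(n,p))} ≥ 1/9`
(`l1_monotone_parityOn_ge`; levels `1 → 2` shifting, `Pr[#(y ∩ T) = 1] = #T·p·(1-p)^{#T-1} ≥ (7/8)e⁻¹` by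
`pow_one_sub_ge_of_mul_le_one`: `(1-p)^{t-1} ≥ e⁻¹ > 9/25` whenever `t·p ≤ 1`). Used by `ClosenessAllK.lean` at every `p_c(k)`.

Work file `Summits/PneNP/PneNP/Cruxes/MonotoneContinuation/Disproof.lean`; refuter seat refuter-cdisprove-stmt-PneNP-18471-0, 2026-08-17.
-/

set_option linter.dupNamespace false

namespace Summit.PneNP.PneNP.Theorems.MonotoneContinuation.Negative

open Literature.Computability.Complexity hiding supp mem_supp
open Finset hiding slice
open Filter hiding mem_sdiff
open Classical
open Summit.PneNP.PneNP.Theorems.ConstantBand.Negative (Edge thr Central central_thr slice)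
open Summit.PneNP.PneNP.Theorems.SliceACZero.Negative (supp mem_supp card_supp supp_injective supp_indicator)
open Summit.PneNP.PneNP.Theorems.SingleThreshold.Negative (pc pc_nonneg pc_le_one gnpProb_and_eq_mul gnpProb_forall_off)
open Summit.PneNP.PneNP.Theorems.SliceTargetSplit (Comp nbhd mem_nbhd transport ind l1 nbhdCard
  ind_nonneg ind_le_one l1_triangle l1_eq_sum_slices)
open Summit.PneNP.PneNP.Theorems (binomialWeight_sum_range binomialWeight_nonneg binomialWeight_tail_le card_slice
  eventually_window tendsto_mean central_add_le)

noncomputable section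

variable {n : ℕ}
/-- `(1 - p)^{t-1} ≥ e⁻¹ > 9/25` whenever `0 < p < 1`, `1 ≤ t` and `t·p ≤ 1` (real-exponent form of `(1 + 1/u)^u ≤ e`,
`u = 1/p - 1 ≥ t - 1`). [folklore] -/
theorem pow_one_sub_ge_of_mul_le_one {p : ℝ} {t : ℕ} (hp0 : 0 < p) (hp1 : p < 1) (ht : 1 ≤ t)
    (htp : (t : ℝ) * p ≤ 1) : (9 / 25 : ℝ) ≤ (1 - p) ^ (t - 1) := by
  have hinv : 1 < 1 / p := (one_lt_div hp0).2 hp1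
  set u : ℝ := 1 / p - 1 with hu
  have hu0 : 0 < u := by rw [hu]; linarith
  have h1p : 0 < 1 - p := by linarith
  have h1p' : 1 - p ≤ 1 := by linarith
  -- `1 - p = (1 + 1/u)⁻¹`
  have hp' : p = 1 / (u + 1) := by rw [hu]; field_simp; ring
  have hbase : 1 - p = (1 + 1 / u)⁻¹ := by
    rw [hp']
    have hu1 : u + 1 ≠ 0 := by linarith
    field_simp
    ring
  -- the exponent: `t - 1 ≤ u`
  have hexp : ((t - 1 : ℕ) : ℝ) ≤ u := by
    rw [Nat.cast_sub ht, Nat.cast_one, hu]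
    have : (t : ℝ) ≤ 1 / p := by rw [le_div_iff₀ hp0]; exact htp
    linarith
  -- `(1 + 1/u)^u ≤ e`
  have hle : (1 + 1 / u) ^ u ≤ Real.exp 1 := by
    have h1 : (1 : ℝ) + 1 / u ≤ Real.exp (1 / u) := by linarith [Real.add_one_le_exp (1 / u)]
    calc (1 + 1 / u) ^ u ≤ (Real.exp (1 / u)) ^ u := Real.rpow_le_rpow (by positivity) h1 hu0.le
      _ = Real.exp (1 / u * u) := (Real.exp_mul _ _).symm
      _ = Real.exp 1 := by rw [one_div, inv_mul_cancel₀ hu0.ne']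
  have hpos : 0 < (1 + 1 / u) ^ u := Real.rpow_pos_of_pos (by positivity) _
  have he : Real.exp 1 < 25 / 9 := lt_trans Real.exp_one_lt_d9 (by norm_num)
  calc (9 / 25 : ℝ) = (25 / 9 : ℝ)⁻¹ := by norm_num
    _ ≤ (Real.exp 1)⁻¹ := by rw [inv_le_inv₀ (by norm_num) (Real.exp_pos 1)]; exact he.le
    _ ≤ ((1 + 1 / u) ^ u)⁻¹ := by rw [inv_le_inv₀ (Real.exp_pos 1) hpos]; exact hle
    _ = (1 - p) ^ u := by rw [hbase, Real.inv_rpow (by positivity)]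
    _ ≤ (1 - p) ^ (((t - 1 : ℕ) : ℝ)) := Real.rpow_le_rpow_of_exponent_ge h1p h1p' hexp
    _ = (1 - p) ^ (t - 1) := Real.rpow_natCast _ _

/-- **Isoperimetric distance of a sparse parity from monotone functions** (general form of `l1_monotone_parity_ge`): for an
edge set `T` with `#T ≥ 2`, `7/8 ≤ #T·p ≤ 1` and `0 < p ≤ 1/8`, every monotone Boolean `F` satisfies
`‖𝟙[F] − 𝟙[parity of #(· ∩ T)]‖_{L¹(G(n,p))} ≥ 1/9` (levels `1 → 2` shifting; `Pr[#(y ∩ T) = 1] = #T·p·(1-p)^{#T-1} ≥ (7/8)e⁻¹`). [folklore] -/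
theorem l1_monotone_parityOn_ge {p : ℝ} (hp0 : 0 < p) (hp8 : p ≤ 1 / 8) (T : Finset (Edge n)) (ht2 : 2 ≤ #T)
    (htp1 : (#T : ℝ) * p ≤ 1) (htp7 : (7 / 8 : ℝ) ≤ #T * p) (F : (Edge n → Bool) → Bool) (hF : Monotone F) :
    (1 / 9 : ℝ) ≤ l1 n p (ind F) (ind (parityOn T)) := by
  set w := gnpWeight n p with hw
  have hp1 : p < 1 := by linarith
  have h1p : 0 < 1 - p := by linarith
  have hw0 : ∀ y, 0 ≤ w y := fun y => gnpWeight_nonneg hp0.le hp1.le y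
  set L1 := (univ : Finset (Edge n → Bool)).filter fun y => #(T ∩ supp y) = 1 with hL1
  set L2 := (univ : Finset (Edge n → Bool)).filter fun y => #(T ∩ supp y) = 2 with hL2
  set L1F := L1.filter fun y => F y = true with hL1F
  set L2F := L2.filter fun y => F y = true with hL2F
  have hdisj : Disjoint L1 L2 := by
    rw [hL1, hL2, disjoint_filter]
    intro y _ h1 h2
    omega
  set Err := l1 n p (ind F) (ind (parityOn T)) with hErr
  set A := ∑ y ∈ L1F, w y with hA
  set M1 := ∑ y ∈ L1, w y with hM1
  set S2 := ∑ y ∈ L2F, w y with hS2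
  -- (1) restrict the error to the two levels
  have hErr_ge : M1 - A + S2 ≤ Err := by
    have h1 : ∑ y ∈ L1 ∪ L2, w y * |ind F y - ind (parityOn T) y| ≤ Err :=
      sum_le_sum_of_subset_of_nonneg (subset_univ _) fun y _ _ => mul_nonneg (hw0 y) (abs_nonneg _)
    rw [sum_union hdisj] at h1
    have hL1sum : ∑ y ∈ L1, w y * |ind F y - ind (parityOn T) y| = M1 - A := by
      have : ∀ y ∈ L1, w y * |ind F y - ind (parityOn T) y| = w y - (if F y = true then w y else 0) := by
        intro y hy
        have hpar : parityOn T y = true := parityOn_of_card_eq_one (mem_filter.1 hy).2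
        unfold ind
        rw [hpar]
        cases F y <;> simp
      rw [sum_congr rfl this, sum_sub_distrib, ← sum_filter]
    have hL2sum : ∑ y ∈ L2, w y * |ind F y - ind (parityOn T) y| = S2 := by
      have : ∀ y ∈ L2, w y * |ind F y - ind (parityOn T) y| = (if F y = true then w y else 0) := by
        intro y hy
        have hpar : parityOn T y = false := parityOn_of_card_eq_two (mem_filter.1 hy).2
        unfold ind
        rw [hpar]
        cases F y <;> simp
      rw [sum_congr rfl this, ← sum_filter]
    linarith [hL1sum, hL2sum, h1]
  -- (2) shifting: `2·S2 ≥ (#T - 1)·(p/(1-p))·A`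
  have hshift : ((#T : ℝ) - 1) * (p / (1 - p)) * A ≤ 2 * S2 := by
    set P := (L1F ×ˢ T).filter fun q : (Edge n → Bool) × Edge n => q.1 q.2 = false with hP
    set g : (Edge n → Bool) × Edge n → (Edge n → Bool) := fun q => Function.update q.1 q.2 true with hg
    have hmaps : ∀ q ∈ P, g q ∈ L2F := by
      rintro ⟨y, e⟩ hq
      simp only [hP, mem_filter, mem_product] at hq
      obtain ⟨⟨hy, he⟩, hye⟩ := hq
      obtain ⟨hy1, hFy⟩ := mem_filter.1 hy
      have hcard1 : #(T ∩ supp y) = 1 := (mem_filter.1 hy1).2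
      have henot : e ∉ T ∩ supp y := by
        rw [mem_inter, mem_supp, hye]
        simp
      rw [hL2F, mem_filter, hL2, mem_filter]
      refine ⟨⟨mem_univ _, ?_⟩, ?_⟩
      · show #(T ∩ supp (Function.update y e true)) = 2
        rw [supp_update_true, inter_insert_of_mem he, card_insert_of_notMem henot, hcard1]
      · have := hF (le_update_true y e)
        rw [hFy] at this
        exact top_le_iff.1 this
    have hfib : ∀ z ∈ L2F, (#(P.filter fun q => g q = z) : ℝ) ≤ 2 := by
      intro z hz
      have hz2 : #(T ∩ supp z) = 2 := (mem_filter.1 (mem_filter.1 hz).1).2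
      have hle : #(P.filter fun q => g q = z) ≤ #(T ∩ supp z) := by
        refine card_le_card_of_injOn (fun q => q.2) ?_ ?_
        · rintro ⟨y, e⟩ hq
          simp only [mem_coe, mem_filter, hP, mem_product] at hq
          obtain ⟨⟨⟨_, he⟩, _⟩, hgz⟩ := hq
          rw [mem_coe, mem_inter, mem_supp]
          refine ⟨he, ?_⟩
          rw [← hgz]
          simp [hg]
        · rintro ⟨y, e⟩ hq ⟨y', e'⟩ hq' (hee : e = e')
          simp only [mem_coe, mem_filter, hP, mem_product] at hq hq'
          obtain ⟨⟨_, hye⟩, hgz⟩ := hq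
          obtain ⟨⟨_, hye'⟩, hgz'⟩ := hq'
          subst hee
          have hy : y = Function.update z e false := by
            rw [← hgz, hg]
            simp only [Function.update_idem]
            rw [← hye, Function.update_eq_self]
          have hy' : y' = Function.update z e false := by
            rw [← hgz', hg]
            simp only [Function.update_idem]
            rw [← hye', Function.update_eq_self]
          rw [hy, hy']
      calc (#(P.filter fun q => g q = z) : ℝ) ≤ #(T ∩ supp z) := by exact_mod_cast hle
        _ = 2 := by rw [hz2]; norm_num
    have hsum_le : ∑ q ∈ P, w (g q) ≤ 2 * S2 := by
      rw [← sum_fiberwise_of_maps_to' hmaps, hS2, mul_sum]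
      refine sum_le_sum fun z hz => ?_
      rw [sum_const, nsmul_eq_mul]
      exact mul_le_mul_of_nonneg_right (hfib z hz) (hw0 z)
    have hsum_eq : ∑ q ∈ P, w (g q) = ((#T : ℝ) - 1) * (p / (1 - p)) * A := by
      rw [hP, sum_filter, sum_product, hA, mul_sum]
      refine sum_congr rfl fun y hy => ?_
      have hy1 : #(T ∩ supp y) = 1 := (mem_filter.1 (mem_filter.1 hy).1).2
      have hinner : ∀ e ∈ T, (if y e = false then w (g (y, e)) else 0) = if y e = false then w y * (p / (1 - p)) else 0 := by
        intro e _
        split_ifs with hye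
        · rw [hg]
          show gnpWeight n p (Function.update y e true) = gnpWeight n p y * (p / (1 - p))
          rw [mul_div_assoc', eq_div_iff h1p.ne']
          exact gnpWeight_update_true p hye
        · rfl
      rw [sum_congr rfl hinner, ← sum_filter, sum_const, nsmul_eq_mul]
      have hoff : #(T.filter fun e => y e = false) = #T - 1 := by
        have h := Finset.card_filter_add_card_filter_not (s := T) (fun e => y e = true)
        have hon : T.filter (fun e => y e = true) = T ∩ supp y := by
          ext e; simp [mem_supp]
        have hoff' : T.filter (fun e => ¬ y e = true) = T.filter (fun e => y e = false) := by
          ext e; simp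
        rw [hon, hoff', hy1] at h
        omega
      rw [hoff, Nat.cast_sub (by omega)]
      push_cast
      ring
    rw [← hsum_eq]
    exact hsum_le
  -- (3) the mass of level one: `M1 ≥ #T·p·(1-p)^{#T-1}`
  have hM1 : (#T : ℝ) * p * (1 - p) ^ (#T - 1) ≤ M1 := by
    set Ae : Edge n → Finset (Edge n → Bool) := fun e =>
      univ.filter fun y => y e = true ∧ ∀ e' ∈ T.erase e, y e' = false with hAe
    have hAsub : ∀ e ∈ T, Ae e ⊆ L1 := by
      intro e he y hy
      rw [hAe, mem_filter] at hy
      obtain ⟨-, hye, hoff⟩ := hy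
      rw [hL1, mem_filter]
      refine ⟨mem_univ _, ?_⟩
      have : T ∩ supp y = {e} := by
        ext a
        rw [mem_inter, mem_supp, mem_singleton]
        constructor
        · rintro ⟨haT, hya⟩
          by_contra hne
          have := hoff a (mem_erase.2 ⟨hne, haT⟩)
          rw [hya] at this
          exact Bool.noConfusion this
        · rintro rfl
          exact ⟨he, hye⟩
      rw [this, card_singleton]
    have hAdisj : (T : Set (Edge n)).PairwiseDisjoint Ae := by
      intro e he e' he' hne
      rw [Function.onFun, disjoint_left]
      intro y hy hy'
      rw [hAe, mem_filter] at hy hy'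
      have h1 := hy'.2.2 e (mem_erase.2 ⟨hne, he⟩)
      rw [hy.2.1] at h1
      exact Bool.noConfusion h1
    have hAprob : ∀ e ∈ T, ∑ y ∈ Ae e, w y = p * (1 - p) ^ (#T - 1) := by
      intro e he
      have hind := gnpProb_and_eq_mul ({e} : Finset (Edge n))
        (fun y : Edge n → Bool => y e = true) (fun y => ∀ e' ∈ T.erase e, y e' = false)
        (fun x y hxy => by rw [hxy e (mem_singleton_self e)])
        (fun x y hxy => by
          refine forall₂_congr fun e' he' => ?_
          rw [hxy e' (by rw [mem_singleton]; exact (mem_erase.1 he').1)])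
        p
      have hPe : gnpProb n p (univ.filter fun y : Edge n → Bool => y e = true) = p := by
        have := sum_gnpWeight_filter_forall (n := n) p ({e} : Finset (Edge n))
        simp only [mem_singleton, forall_eq, card_singleton, pow_one] at this
        rw [gnpProb]
        exact this
      have hQe : gnpProb n p (univ.filter fun y : Edge n → Bool => ∀ e' ∈ T.erase e, y e' = false) = (1 - p) ^ (#T - 1) := by
        rw [gnpProb_forall_off, card_erase_of_mem he]
      rw [hPe, hQe] at hind
      rw [← hind, gnpProb]
    calc (#T : ℝ) * p * (1 - p) ^ (#T - 1) = ∑ e ∈ T, p * (1 - p) ^ (#T - 1) := by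
          rw [sum_const, nsmul_eq_mul]; ring
      _ = ∑ e ∈ T, ∑ y ∈ Ae e, w y := sum_congr rfl fun e he => (hAprob e he).symm
      _ = ∑ y ∈ T.biUnion Ae, w y := (sum_biUnion hAdisj).symm
      _ ≤ M1 := sum_le_sum_of_subset_of_nonneg (biUnion_subset.2 hAsub) fun y _ _ => hw0 y
  -- (4) combine
  have hAM : A ≤ M1 := sum_le_sum_of_subset_of_nonneg (filter_subset _ _) fun y _ _ => hw0 y
  have hA0 : 0 ≤ A := sum_nonneg fun y _ => hw0 y
  have ht2' : (2 : ℝ) ≤ #T := by exact_mod_cast ht2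
  have hexpand : ((#T : ℝ) - 1) * p = #T * p - p := by ring
  set κ : ℝ := ((#T : ℝ) - 1) * p / (2 * (1 - p)) with hκ
  have hκ1 : κ ≤ 1 := by
    rw [hκ, div_le_one (by linarith)]; linarith
  have hκ38 : (3 / 8 : ℝ) ≤ κ := by
    rw [hκ, le_div_iff₀ (by linarith)]; nlinarith
  have hκ0 : 0 ≤ κ := by linarith
  have hS2κ : κ * A ≤ S2 := by
    have : κ * A = (((#T : ℝ) - 1) * (p / (1 - p)) * A) / 2 := by
      rw [hκ]; field_simp
    rw [this]
    linarith [hshift]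
  have hmain : κ * M1 ≤ Err := by
    have : κ * M1 ≤ M1 - A + κ * A := by nlinarith
    linarith [hErr_ge]
  have hpow : (9 / 25 : ℝ) ≤ (1 - p) ^ (#T - 1) := pow_one_sub_ge_of_mul_le_one hp0 hp1 (by omega) htp1
  have hκM : (3 / 8 : ℝ) * ((7 / 8) * (9 / 25)) ≤ κ * M1 := by
    have h1 : κ * ((#T : ℝ) * p * (1 - p) ^ (#T - 1)) ≤ κ * M1 := mul_le_mul_of_nonneg_left hM1 hκ0
    have h2 : (7 / 8 : ℝ) * (9 / 25) ≤ (#T : ℝ) * p * (1 - p) ^ (#T - 1) :=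
      mul_le_mul htp7 hpow (by norm_num) (by linarith)
    calc (3 / 8 : ℝ) * ((7 / 8) * (9 / 25)) ≤ κ * ((#T : ℝ) * p * (1 - p) ^ (#T - 1)) :=
          mul_le_mul hκ38 h2 (by norm_num) hκ0
      _ ≤ κ * M1 := h1
  linarith [hκM, hmain]

end

end Summit.PneNP.PneNP.Theorems.MonotoneContinuation.Negative
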